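import Mathlib
import HarnessLib

/-!
# `NoHeavyLowerTail` (crux stmt-CriticalPhenomena-4575), antithetic vdBHK programme: the WEDGE-TRANSFER LEMMA — the rearrangement inequality (R) of a
# polarized antipodal-Kleitman poset transfers antipodal Kleitman to the wedge gluing `T(X;L)`

Support file (seat `prim-ineq-gen-7` gen 51; `--supports stmt-CriticalPhenomena-4575`).  No `sorry`, no definitions.
Memos: run/shared/lean/prim/prim-ineq-gen-7/FINDING-FLOW-g50.md §4h (the rearrangement mechanism (R)), FINDING-FENCE-g51.md (this generation).

SETTING.  `X` a finite partial order with an involution `ι`, antipodal Kleitman (AK) in the up-set form `#(V ∩ ι Y) ≤ #(V ∩ Y)` for all up-sets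
`V, Y` (as in `AntitheticApex`, `AntitheticHalfDouble`), and `L ⊆ X` (in the application a HALF: a down-set with `ι L = X ∖ L`).  The WEDGE GLUING
`T(X;L)` is `X × {RB, RR, BB, BR}` (sheets `1,2,3,4`; the letters are the colours of a new atom `c` and a new top `x` above `c` and the atom `a`
with `L = {a red}`), ordered by: `(s,i) ≤ (s',i)` iff `s ≤ s'`; `RB → BB`, `RR → BR`, `RB → BR` iff `s ≤ s'`; `BB → BR` iff moreover `s ∈ L`;
`RB → RR` iff moreover `s' ∉ L`; `RR → BB` iff moreover `s ∈ L, s' ∉ L`; no other relations; involution `(s,i) ↦ (ι s, 5-i)`.  For `X = Ω_Q`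
(colouring poset of a poset `Q`) and `L = {a red}` (`a` an atom) this is EXACTLY `Ω_{Q ∪ {c,x}}` with `x > a, c` (machine-checked dictionary,
memo §1).  Its up-sets are the quadruples `(A₁,A₂,A₃,A₄)` of up-sets of `X` with the T-PATTERN
  `A₁ ⊆ A₃`, `A₂ ⊆ A₄`, `A₃ ∩ L ⊆ A₄`, `A₁ ∖ L ⊆ A₂`, and the cross conditions `x ∈ A₃ ∩ L, x ≤ y, y ∉ L ⟹ y ∈ A₄`, `x ∈ A₂ ∩ L, x ≤ y, y ∉ L ⟹ y ∈ A₃`,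
and AK of `T(X;L)` reads `Σ_i #(A_i ∩ ι B_{5-i}) ≤ Σ_i #(A_i ∩ B_i)`.
THE REARRANGEMENT INEQUALITY (R) of `(X,L)` (FINDING-FLOW-g50 §4h) is the statement that for all T-pattern quadruple pairs
  `#(A₂ ∩ ι B₃) + #(A₃ ∩ ι B₂) ≤ #(A₂ ∩ B₂) + #(A₃ ∩ B₃) + #((A₄ ∖ A₁) ∩ (B₄ ∖ B₁))`
('the inner-sheet antipodal deficit is paid by the rearrangement slack of the outer sheets alone').
* `AntitheticWedgeTransfer.spread_card` — the bookkeeping identity `#((A₄∖A₁)∩(B₄∖B₁)) + #(A₁∩B₄) + #(A₄∩B₁) = #(A₄∩B₄) + #(A₁∩B₁)` for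
  `A₁ ⊆ A₄`, `B₁ ⊆ B₄`.
* `AntitheticWedgeTransfer.wedge_transfer` — **(R) ∧ AK(X) ⟹ AK(T(X;L))**: for every AK `X`, every `L`, if (R) holds for `(X,L)` then every pair of
  T-pattern quadruples satisfies the AK inequality of `T(X;L)`.  PROOF: `Φ = R(A,B) + AK(A₁,B₄) + AK(A₄,B₁)` (the outer sheets `RB ⊆ BR`).
CONSEQUENCES (memo §2; the hypotheses are machine-certified, not formalised): (R) holds exactly for every rooted poset with ≤ 4 elements (g50, kit
j278937) and — this generation, kit j284847, 81,712,946 admissible pairs × exact min-closure — for the W-fence `c<x>a<y>d` at its END atoms; with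
AK(Ω_W) this lemma gives AK of the colouring poset of the 7-ELEMENT FENCE `F₇ = W ∪_end wedge`, the first fence beyond the exhaustive range.  (R) is
FALSE at the middle atom of W (g50), so the lemma is not a route to trees with a vertex of degree 3.
-/

namespace Summit.CriticalPhenomena.PercolationContinuityZ3.Theorems

open Finset

namespace AntitheticWedgeTransfer

variable {X : Type*} [DecidableEq X]

/-- Bookkeeping for the outer sheets: if `A₁ ⊆ A₄` and `B₁ ⊆ B₄` then
`#((A₄ ∖ A₁) ∩ (B₄ ∖ B₁)) + #(A₁ ∩ B₄) + #(A₄ ∩ B₁) = #(A₄ ∩ B₄) + #(A₁ ∩ B₁)`. [this work] -/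
theorem spread_card (A₁ A₄ B₁ B₄ : Finset X) (hA : A₁ ⊆ A₄) (hB : B₁ ⊆ B₄) :
    ((A₄ \ A₁) ∩ (B₄ \ B₁)).card + (A₁ ∩ B₄).card + (A₄ ∩ B₁).card = (A₄ ∩ B₄).card + (A₁ ∩ B₁).card := by
  classical
  -- split A₄ ∩ B₄ along membership in A₁, then the part outside A₁ along membership in B₁
  have e1 : (A₄ ∩ B₄).card = ((A₄ ∩ B₄).filter (fun x => x ∈ A₁)).card + ((A₄ ∩ B₄).filter (fun x => x ∉ A₁)).card := by
    rw [Finset.card_filter_add_card_filter_not]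
  have e2 : ((A₄ ∩ B₄).filter (fun x => x ∉ A₁)).card =
      (((A₄ ∩ B₄).filter (fun x => x ∉ A₁)).filter (fun x => x ∈ B₁)).card +
      (((A₄ ∩ B₄).filter (fun x => x ∉ A₁)).filter (fun x => x ∉ B₁)).card := by
    rw [Finset.card_filter_add_card_filter_not]
  have e3 : (A₄ ∩ B₁).card = ((A₄ ∩ B₁).filter (fun x => x ∈ A₁)).card + ((A₄ ∩ B₁).filter (fun x => x ∉ A₁)).card := by
    rw [Finset.card_filter_add_card_filter_not]
  -- identifications
  have i1 : (A₄ ∩ B₄).filter (fun x => x ∈ A₁) = A₁ ∩ B₄ := by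
    ext x; simp only [Finset.mem_filter, Finset.mem_inter]
    constructor
    · rintro ⟨⟨_, h2⟩, h3⟩; exact ⟨h3, h2⟩
    · rintro ⟨h1, h2⟩; exact ⟨⟨hA h1, h2⟩, h1⟩
  have i2 : ((A₄ ∩ B₄).filter (fun x => x ∉ A₁)).filter (fun x => x ∈ B₁) = (A₄ ∩ B₁).filter (fun x => x ∉ A₁) := by
    ext x; simp only [Finset.mem_filter, Finset.mem_inter]
    constructor
    · rintro ⟨⟨⟨h1, _⟩, h3⟩, h4⟩; exact ⟨⟨h1, h4⟩, h3⟩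
    · rintro ⟨⟨h1, h2⟩, h3⟩; exact ⟨⟨⟨h1, hB h2⟩, h3⟩, h2⟩
  have i3 : ((A₄ ∩ B₄).filter (fun x => x ∉ A₁)).filter (fun x => x ∉ B₁) = (A₄ \ A₁) ∩ (B₄ \ B₁) := by
    ext x; simp only [Finset.mem_filter, Finset.mem_inter, Finset.mem_sdiff]
    constructor
    · rintro ⟨⟨⟨h1, h2⟩, h3⟩, h4⟩; exact ⟨⟨h1, h3⟩, ⟨h2, h4⟩⟩
    · rintro ⟨⟨h1, h3⟩, ⟨h2, h4⟩⟩; exact ⟨⟨⟨h1, h2⟩, h3⟩, h4⟩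
  have i4 : (A₄ ∩ B₁).filter (fun x => x ∈ A₁) = A₁ ∩ B₁ := by
    ext x; simp only [Finset.mem_filter, Finset.mem_inter]
    constructor
    · rintro ⟨⟨_, h2⟩, h3⟩; exact ⟨h3, h2⟩
    · rintro ⟨h1, h2⟩; exact ⟨⟨hA h1, h2⟩, h1⟩
  rw [i1] at e1; rw [i2, i3] at e2; rw [i4] at e3
  omega

/-- **WEDGE TRANSFER: (R) ∧ AK(X) ⟹ AK(T(X;L)).**  `X` AK in up-set form (`hAK`), `ι` any self-map, `L ⊆ X` any subset; (R) for `(X,L)` in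
the quadruple form (`hR`, quantified over all pairs of T-pattern quadruples of up-sets).  Then every pair of T-pattern quadruples `(A₁,…,A₄)`,
`(B₁,…,B₄)` satisfies the antipodal-Kleitman inequality of the wedge gluing `T(X;L)`:
`Σ_i #(A_i ∩ ι B_{5-i}) ≤ Σ_i #(A_i ∩ B_i)`. [this work] -/
theorem wedge_transfer [PartialOrder X] (ι : X → X)
    (hAK : ∀ V Y : Finset X, (∀ x y, x ≤ y → x ∈ V → y ∈ V) → (∀ x y, x ≤ y → x ∈ Y → y ∈ Y) →
      (V ∩ Y.image ι).card ≤ (V ∩ Y).card)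
    (L : Finset X)
    (hR : ∀ A₁ A₂ A₃ A₄ B₁ B₂ B₃ B₄ : Finset X,
      (∀ x y, x ≤ y → x ∈ A₁ → y ∈ A₁) → (∀ x y, x ≤ y → x ∈ A₂ → y ∈ A₂) →
      (∀ x y, x ≤ y → x ∈ A₃ → y ∈ A₃) → (∀ x y, x ≤ y → x ∈ A₄ → y ∈ A₄) →
      (∀ x y, x ≤ y → x ∈ B₁ → y ∈ B₁) → (∀ x y, x ≤ y → x ∈ B₂ → y ∈ B₂) →
      (∀ x y, x ≤ y → x ∈ B₃ → y ∈ B₃) → (∀ x y, x ≤ y → x ∈ B₄ → y ∈ B₄) →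
      A₁ ⊆ A₃ → A₂ ⊆ A₄ → (∀ x, x ∈ L → x ∈ A₃ → x ∈ A₄) → (∀ x, x ∉ L → x ∈ A₁ → x ∈ A₂) →
      (∀ x y, x ≤ y → x ∈ L → y ∉ L → x ∈ A₃ → y ∈ A₄) → (∀ x y, x ≤ y → x ∈ L → y ∉ L → x ∈ A₂ → y ∈ A₃) →
      B₁ ⊆ B₃ → B₂ ⊆ B₄ → (∀ x, x ∈ L → x ∈ B₃ → x ∈ B₄) → (∀ x, x ∉ L → x ∈ B₁ → x ∈ B₂) →
      (∀ x y, x ≤ y → x ∈ L → y ∉ L → x ∈ B₃ → y ∈ B₄) → (∀ x y, x ≤ y → x ∈ L → y ∉ L → x ∈ B₂ → y ∈ B₃) →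
      (A₂ ∩ B₃.image ι).card + (A₃ ∩ B₂.image ι).card ≤
        (A₂ ∩ B₂).card + (A₃ ∩ B₃).card + ((A₄ \ A₁) ∩ (B₄ \ B₁)).card)
    (A₁ A₂ A₃ A₄ B₁ B₂ B₃ B₄ : Finset X)
    (hA₁ : ∀ x y, x ≤ y → x ∈ A₁ → y ∈ A₁) (hA₂ : ∀ x y, x ≤ y → x ∈ A₂ → y ∈ A₂)
    (hA₃ : ∀ x y, x ≤ y → x ∈ A₃ → y ∈ A₃) (hA₄ : ∀ x y, x ≤ y → x ∈ A₄ → y ∈ A₄)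
    (hB₁ : ∀ x y, x ≤ y → x ∈ B₁ → y ∈ B₁) (hB₂ : ∀ x y, x ≤ y → x ∈ B₂ → y ∈ B₂)
    (hB₃ : ∀ x y, x ≤ y → x ∈ B₃ → y ∈ B₃) (hB₄ : ∀ x y, x ≤ y → x ∈ B₄ → y ∈ B₄)
    (a13 : A₁ ⊆ A₃) (a24 : A₂ ⊆ A₄) (a34 : ∀ x, x ∈ L → x ∈ A₃ → x ∈ A₄) (a12 : ∀ x, x ∉ L → x ∈ A₁ → x ∈ A₂)
    (aC34 : ∀ x y, x ≤ y → x ∈ L → y ∉ L → x ∈ A₃ → y ∈ A₄) (aC23 : ∀ x y, x ≤ y → x ∈ L → y ∉ L → x ∈ A₂ → y ∈ A₃)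
    (b13 : B₁ ⊆ B₃) (b24 : B₂ ⊆ B₄) (b34 : ∀ x, x ∈ L → x ∈ B₃ → x ∈ B₄) (b12 : ∀ x, x ∉ L → x ∈ B₁ → x ∈ B₂)
    (bC34 : ∀ x y, x ≤ y → x ∈ L → y ∉ L → x ∈ B₃ → y ∈ B₄) (bC23 : ∀ x y, x ≤ y → x ∈ L → y ∉ L → x ∈ B₂ → y ∈ B₃) :
    (A₁ ∩ B₄.image ι).card + (A₂ ∩ B₃.image ι).card + (A₃ ∩ B₂.image ι).card + (A₄ ∩ B₁.image ι).card ≤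
      (A₁ ∩ B₁).card + (A₂ ∩ B₂).card + (A₃ ∩ B₃).card + (A₄ ∩ B₄).card := by
  classical
  -- the outer sheets are nested: RB ⊆ BR on L (via BB) and off L (via RR)
  have a14 : A₁ ⊆ A₄ := by
    intro x hx
    by_cases hL : x ∈ L
    · exact a34 x hL (a13 hx)
    · exact a24 (a12 x hL hx)
  have b14 : B₁ ⊆ B₄ := by
    intro x hx
    by_cases hL : x ∈ L
    · exact b34 x hL (b13 hx)
    · exact b24 (b12 x hL hx)
  have hr := hR A₁ A₂ A₃ A₄ B₁ B₂ B₃ B₄ hA₁ hA₂ hA₃ hA₄ hB₁ hB₂ hB₃ hB₄ a13 a24 a34 a12 aC34 aC23 b13 b24 b34 b12 bC34 bC23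
  have ak1 := hAK A₁ B₄ hA₁ hB₄
  have ak2 := hAK A₄ B₁ hA₄ hB₁
  have sp := spread_card A₁ A₄ B₁ B₄ a14 b14
  omega

end AntitheticWedgeTransfer

end Summit.CriticalPhenomena.PercolationContinuityZ3.Theorems
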